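import Literature.MathematicalPhysics.QuantumFieldTheory.Z2HiggsFiniteTemperaturePolyakovLoops
import Literature.Probability.LatticeModels.PlaneRotatorTorusBoxCriterion
import Literature.Probability.LatticeModels.PlaneRotatorAizenmanSimonWindow
import Literature.Probability.LatticeModels.TorusTwoPointDecay
import Literature.Probability.LatticeModels.XYTorusFreeBoxComparison
import HarnessLib

/-!
# The `J_M → ∞` bound for abelian finite-temperature gauge theories: Ginibre's infinite-field
# (freezing) limit, the stack of `L₀` independent layers, and — for `U(1)` — a stack of XY models

Statement-and-proof file (topic `Literature/MathematicalPhysics/QuantumFieldTheory`; everything PROVED,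
no named facts) in the vocabulary of the barrier file
`Literature.Barriers.QuantumFields.FiniteTemperatureDeconfinement` (Borgs–Seiler 1983 §II.3: the lattice
`ℤ_{L₀} × (ℤ/L)^d`, Wilson action with electric / magnetic couplings `J_E, J_M`, the Polyakov two-point
function `polyakovCorrelation ρ J_E J_M x` (II.22), thermodynamic limits, Polyakov's criterion
`HasPolyakovLongRangeOrder`) and of the seat's gauge–Higgs file
`Z2HiggsFiniteTemperaturePolyakovLoops` (`ThermalHiggs.higgsExpectation` with hopping parameters `κt`,
`κs`; §5 `AbelianHiggs`: Ginibre's inequalities for a compact abelian `Γ` in the one-dimensional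
representation `charRep φ`).

Borgs–Seiler, §IV pp. 358–359: "The other extreme case `J_M → ∞` is also easy to understand. In this
limit the 'magnetic fields' `v_∂P` are frozen out, the `v` variables become a pure gauge and can be
gauged away. One is left with a stack of `L₀` copies of the `G × G` spin model; the transition point
becomes therefore independent of `L₀` … It is now highly plausible that the true transition point will
lie between the values obtained for `J_M = 0` and `J_M → ∞`. For abelian models this is of course again
implied by Ginibre's inequalities." This file proves the abelian statement, for `U(1)` (and for every
compact abelian `Γ` with surjective squaring and a faithful character), with the stack identified as
the classical XY model on the torus `(ℤ/L)^d` (tree `torusXY d L`), and draws the consequence that the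
tree's XY high-temperature results make available: TEMPERATURE-INDEPENDENT POLYAKOV CONFINEMENT OF
`U(1)` AND `U(N)` IN THE AIZENMAN–SIMON WINDOW `N·J_E < 2β_c(d)`.

## Contents (all PROVED; 0 named facts)

* §1 `LaplaceFreezing.tendsto_tilted_ratio` — **Ginibre's infinite-field limit** (Ginibre 1970 §2
  Model 2, (2.22)–(2.24): "when `λ` tends to infinity, `σ_λ` tends … to the measure `σ̄`") as an
  abstract Laplace-concentration lemma: on a compact space with a finite measure charging open sets,
  `∫ G e^{κΨ} / ∫ e^{κΨ} → c` whenever a continuous retraction `π` onto the maximisers of `Ψ` satisfies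
  `∫ (G∘π) e^{κΨ} = c ∫ e^{κΨ}` (elementary: compactness gap off a neighbourhood of the maximisers, a
  window of positive mass around them).
* §2 (private) independence of disjoint blocks of links under the product Haar measure (Mathlib
  `iIndepFun_pi`), for real- and complex-valued observables.
* §3 **Freezing the space-like links** (`AbelianStack.freeze`, `spaceField`, `frozenExpectation`):
  `matterTerm (charRep φ) 0 κs = κs·Ψ`; the maximisers of `Ψ` are the frozen configurations
  (`freeze_eq_self_of_isMax`, faithful `φ`); ★ `AbelianStack.tendsto_higgsExpectation_frozen`: the
  gauge–Higgs expectation with space-like hopping `κs` converges as `κs → ∞` to the FROZEN expectation,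
  for every continuous observable and all `J_E, J_M`; ★ `AbelianStack.polyakovCorrelation_le_frozen`:
  `G_L^{Γ}(x; J_E, J_M) ≤ ⟨Re χ_x⟩^{frozen}_{J_E}` for `J_E, J_M ≥ 0` (Griffiths II in `κs`, tree
  `AbelianHiggs.higgsExpectation_reChar_mono`, then the limit) — Borgs–Seiler's "between `J_M = 0` and
  `J_M → ∞`", upper half.
* §4 **The frozen system is a stack of `L₀` independent layers** (`layerChar`, `layerPair`,
  `layerHaar`, `layerTwoPoint`, `slice`): the frozen action is the sum of the layer Hamiltonians plus a
  constant (`minusAction_freeze`, `weight_freeze`), the frozen Polyakov pair is the product of the layer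
  pair variables (`coe_pairChar_freeze`), slices are independent and identically distributed (change
  of variables `pi_map_comp_injective`), the complex layer pair integral is real (inversion
  invariance); ★ `AbelianStack.frozenExpectation_pairChar`:
  `⟨Re χ_x⟩^{frozen}_{J_E} = (⟨Re φ(τ_0 τ_x⁻¹)⟩^{layer}_{J_E})^{L₀}`.
* §5 **`U(1)`**: `layerTwoPoint_u1_eq_torusXY` (the layer is the tree's plane rotator `torusXY d L` at
  coupling `J_E`); ★ `u1_polyakovCorrelation_le_torusXY_pow`:
  **`G_L^{U(1)}(x; J_E, J_M) ≤ (⟨cos(θ_0 − θ_x)⟩^{XY}_{(ℤ/L)^d, J_E})^{L₀}`** for all `J_E, J_M ≥ 0`, every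
  `L₀`, `L`, `x`; ★ `unitaryGroup_abs_polyakovCorrelation_le_torusXY_pow` (`U(N)` through its centre
  `U(1)`, tree `unitaryGroup_abs_polyakovCorrelation_le_u1`): `|G_L^{U(N)}| ≤ N² (⟨cos⟩^{XY}_{N J_E})^{L₀}`;
  `exists_uniform_decay_torusXY` (the torus XY two-point function decays exponentially, uniformly in
  `L`, for `K < 2β_c(d)`: the tree's Aizenman–Simon window `exists_nnBoxShellSum_lt_one_of_lt_two_mul_criticalBeta`
  with Lieb's box criterion on the torus `torusXY_expectJ_cosDiff_le_pow_nnBoxShellSum`);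
  ★ `u1_polyakovCorrelation_decay_of_lt_two_mul_criticalBeta`, ★ `u1_tendsto_zero_of_lt_two_mul_criticalBeta`,
  ★ `unitaryGroup_tendsto_zero_of_lt_two_mul_criticalBeta`: for `d ≥ 2` and `N·J_E < 2β_c(d)` every
  thermodynamic limit of the `U(1)` / `U(N)` Polyakov two-point function tends to `0` at EVERY temporal
  extent `L₀` and EVERY `J_M ≥ 0` — Polyakov confinement on a strip twice as wide as the one obtained
  through the subgroup `{±1}` and the Ising stack (`FiniteTemperatureCentreIsingBound.lean`);
  `u1_two_mul_criticalBeta_le_of_hasPolyakovLongRangeOrder`,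
  `unitaryGroup_two_mul_criticalBeta_le_of_hasPolyakovLongRangeOrder` (long-range order forces
  `N·J_E ≥ 2β_c(d)`; with the tree's `u1_hasPolyakovLongRangeOrder_of_lt` the `U(1)` transition at
  temporal extent `L₀`, `d ≥ 3`, sits in `[2β_c(d), 2L₀(d·I_d + 1)]`).

* §6 **`ℤ_n` (`n` odd) and `SU(N)` through an odd central subgroup**:
  `zn_polyakovCorrelation_le_clockLayer_pow_of_odd` (`G^{ℤ_n} ≤ (ℤ_n-clock layer)^{L₀}`),
  `suN_abs_polyakovCorrelation_le_clockLayer_pow` (`|G^{SU(N)}| ≤ N²(clock_n at N J_E)^{L₀}`, odd `n ∣ N`),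
  `su3_abs_polyakovCorrelation_le_clockLayer_pow`, and the CONDITIONAL transfer
  `suN_tendsto_zero_of_clockLayer_decay` (a volume-uniform subcritical decay bound for the clock layer —
  an explicit hypothesis, the input the tree lacks — gives `SU(N)` Polyakov confinement at every `L₀`).

## Honest framing

Abelian / centre statements on the lattice, strong-coupling side (a confinement strip), finite
volume with bounds uniform in the volume; the point is the uniformity in `L₀` and `J_M` and the use of
correlation inequalities instead of expansions. Not covered: `ℤ_n` with `n` even ≥ 4 (Ginibre needs
surjective squaring; `ℤ₂` is the GKS file `Z2FiniteTemperatureIsingStack.lean`), `SU(N)` with `N` odd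
(no subcritical-sharpness input for clock models in the tree), anything at weak coupling or in the
continuum. The Yang–Mills mass gap (Clay) is NOT proved by any of this; in the `ym` ladder only the
conditional finite-`𝕋⁴` rung `BalabanLadder.UV` is closed.

## References

* C. Borgs, E. Seiler, *Lattice Yang–Mills theory at nonzero temperature and the confinement
  problem*, Commun. Math. Phys. 91 (1983) 329–380: §II.3 (II.22)–(II.23) p. 337; §II.4 (II.55)–(II.56)
  p. 343; §III.3 p. 354; §IV pp. 358–359. [BorgsSeiler1983]
* J. Ginibre, *General formulation of Griffiths' inequalities*, Commun. Math. Phys. 16 (1970)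
  310–328: Prop. 3; §2 Model 2, eqs. (2.22)–(2.24) (p. 322); Model 3 (plane rotators). [Ginibre1970]
* R. Marra, S. Miracle-Solé, Commun. Math. Phys. 67 (1979) 233–240, §1 eq. (3). [MarraMiraclesole1979]
* H. Grosse, *Models in Statistical Physics and Quantum Field Theory* (1988), §4.2.4 (4.134). [Grosse1988]
* M. Aizenman, B. Simon, Phys. Lett. 76A (1980) 281–282, eqs. (1)–(2). [AizenmanSimon1980RotorIsing]
* E. H. Lieb, Commun. Math. Phys. 77 (1980) 127–135, Theorem 4 and p. 128. [Lieb1980]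
-/

noncomputable section

open MeasureTheory Filter Finset ProbabilityTheory
open scoped Topology BigOperators ComplexConjugate
open Literature.Probability.LatticeModels Literature.MathematicalPhysics.QuantumLattice
open Literature.Barriers.QuantumFields Literature.Barriers.QuantumFields.FiniteTemperature

namespace Literature.MathematicalPhysics.QuantumFieldTheory

/-! ### 1. Laplace concentration of tilted measures (Ginibre's infinite-field limit) -/

namespace LaplaceFreezing

variable {Ω : Type*} [TopologicalSpace Ω] [CompactSpace Ω] [SecondCountableTopology Ω]
  [MeasurableSpace Ω] [OpensMeasurableSpace Ω] (μ : Measure Ω) [IsFiniteMeasure μ] [μ.IsOpenPosMeasure]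

/-- **Laplace concentration of tilted measures onto the maximisers of the tilt.** Let `Ω` be compact,
`μ` a finite measure charging every non-empty open set, `Ψ, G` continuous, and `π : Ω → Ω` a
continuous map fixing every maximiser of `Ψ`. If the tilted integrals of `G ∘ π` are EXACTLY
`c · ∫ e^{κΨ} dμ` for every `κ` (in the applications: `π` projects onto coordinates independent of
`Ψ`), then `∫ G e^{κΨ} dμ / ∫ e^{κΨ} dμ → c` as `κ → ∞`: the tilted probability measures concentrate
where `Ψ` is maximal, and there `G = G ∘ π`. (The "infinite external field" limit behind Ginibre's
remark that Griffiths inequalities survive freezing a subset of the variables.)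
[cite: Ginibre1970, §2 Model 2, eqs. (2.22)–(2.24) (p. 322)] -/
theorem tendsto_tilted_ratio [Nonempty Ω] {Ψ G : Ω → ℝ} (hΨ : Continuous Ψ) (hG : Continuous G)
    {π : Ω → Ω} (hπ : Continuous π) (hfix : ∀ σ, (∀ τ, Ψ τ ≤ Ψ σ) → π σ = σ) {c : ℝ}
    (hind : ∀ κ : ℝ, ∫ σ, G (π σ) * Real.exp (κ * Ψ σ) ∂μ = c * ∫ σ, Real.exp (κ * Ψ σ) ∂μ) :
    Tendsto (fun κ : ℝ => (∫ σ, G σ * Real.exp (κ * Ψ σ) ∂μ) / ∫ σ, Real.exp (κ * Ψ σ) ∂μ)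
      atTop (𝓝 c) := by
  -- a bound on `G`
  obtain ⟨B, hB⟩ := isCompact_univ.exists_bound_of_continuousOn hG.continuousOn
  have hB' : ∀ σ, |G σ| ≤ B := fun σ => by simpa [Real.norm_eq_abs] using hB σ (Set.mem_univ σ)
  have hB0 : 0 ≤ B := (abs_nonneg _).trans (hB' (Classical.arbitrary Ω))
  -- the maximum of `Ψ`
  obtain ⟨σ₀, -, hσ₀⟩ := isCompact_univ.exists_isMaxOn Set.univ_nonempty hΨ.continuousOn
  have hM : ∀ τ, Ψ τ ≤ Ψ σ₀ := fun τ => hσ₀ (Set.mem_univ τ)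
  set M : ℝ := Ψ σ₀ with hMdef
  rw [Metric.tendsto_nhds]
  intro ε hε
  -- the open set where `G ≈ G ∘ π`; it contains the maximisers
  set U : Set Ω := {σ | |G σ - G (π σ)| < ε / 2} with hU
  have hUo : IsOpen U := isOpen_lt ((hG.sub (hG.comp hπ)).abs) continuous_const
  have hZU : ∀ σ, (∀ τ, Ψ τ ≤ Ψ σ) → σ ∈ U := fun σ h => by
    show |G σ - G (π σ)| < ε / 2
    rw [hfix σ h, sub_self, abs_zero]; exact half_pos hε
  -- the gap `η` off `U`
  obtain ⟨η, hη, hKη⟩ : ∃ η : ℝ, 0 < η ∧ ∀ σ, σ ∉ U → Ψ σ ≤ M - η := by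
    rcases (Uᶜ).eq_empty_or_nonempty with hKe | hKne
    · refine ⟨1, one_pos, fun σ hσ => ?_⟩
      have h' : σ ∈ Uᶜ := hσ
      rw [hKe] at h'
      exact absurd h' (Set.notMem_empty σ)
    · obtain ⟨σ₁, hσ₁K, hmax⟩ :=
        hUo.isClosed_compl.isCompact.exists_isMaxOn hKne hΨ.continuousOn
      have hlt : Ψ σ₁ < M := by
        refine lt_of_le_of_ne (hM σ₁) fun heq => hσ₁K (hZU σ₁ fun τ => ?_)
        rw [heq]; exact hM τ
      refine ⟨M - Ψ σ₁, sub_pos.2 hlt, fun σ hσ => ?_⟩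
      have := isMaxOn_iff.1 hmax σ hσ
      linarith
  -- the window `W` around the maximisers has positive mass
  set W : Set Ω := {σ | M - η / 2 < Ψ σ} with hW
  have hWo : IsOpen W := isOpen_lt continuous_const hΨ
  have hσ₀W : σ₀ ∈ W := by
    show M - η / 2 < Ψ σ₀
    linarith
  have hw : 0 < μ.real W := by
    rw [measureReal_def]
    exact ENNReal.toReal_pos (hWo.measure_pos μ ⟨σ₀, hσ₀W⟩).ne' (measure_ne_top μ W)
  set m : ℝ := μ.real Set.univ with hm
  have hm0 : 0 ≤ m := measureReal_nonneg
  -- the error term decays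
  have hdecay : Tendsto (fun κ : ℝ => 2 * B * m / μ.real W * Real.exp (-(κ * (η / 2)))) atTop (𝓝 0) := by
    have h := (Real.tendsto_exp_neg_atTop_nhds_zero.comp
      (tendsto_id.atTop_mul_const (half_pos hη))).const_mul (2 * B * m / μ.real W)
    simpa using h
  filter_upwards [hdecay.eventually (gt_mem_nhds (half_pos hε)), eventually_ge_atTop (0 : ℝ)]
    with κ hsmall hκ0
  -- the tilted integrals at this `κ`
  set E : Ω → ℝ := fun σ => Real.exp (κ * Ψ σ) with hE
  have hEc : Continuous E := Real.continuous_exp.comp (continuous_const.mul hΨ)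
  have hEpos : ∀ σ, 0 < E σ := fun σ => Real.exp_pos _
  have hEi : Integrable E μ := integrable_of_continuous_of_isFiniteMeasure μ hEc
  have hGEi : Integrable (fun σ => G σ * E σ) μ := integrable_of_continuous_of_isFiniteMeasure μ (hG.mul hEc)
  have hGπEi : Integrable (fun σ => G (π σ) * E σ) μ :=
    integrable_of_continuous_of_isFiniteMeasure μ ((hG.comp hπ).mul hEc)
  set Z : ℝ := ∫ σ, E σ ∂μ with hZ
  -- `Z ≥ e^{κ(M - η/2)} μ(W) > 0`
  have hZlow : Real.exp (κ * (M - η / 2)) * μ.real W ≤ Z := by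
    have hWint := setIntegral_ge_of_const_le (c := Real.exp (κ * (M - η / 2))) (f := E)
      hWo.measurableSet (measure_ne_top μ W) (fun σ hσ => by
        have hσ' : M - η / 2 < Ψ σ := hσ
        exact Real.exp_le_exp.2 (mul_le_mul_of_nonneg_left hσ'.le hκ0)) hEi.integrableOn
    rw [smul_eq_mul, mul_comm] at hWint
    exact hWint.trans (setIntegral_le_integral hEi (ae_of_all _ fun σ => (hEpos σ).le))
  have hZpos : 0 < Z := lt_of_lt_of_le (mul_pos (Real.exp_pos _) hw) hZlow
  -- the numerator minus `c Z`, pointwise and integrated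
  have hpt : ∀ σ, |G σ * E σ - G (π σ) * E σ| ≤ ε / 2 * E σ + 2 * B * Real.exp (κ * (M - η)) := by
    intro σ
    rw [← sub_mul, abs_mul, abs_of_pos (hEpos σ)]
    by_cases hσ : σ ∈ U
    · have h1 : |G σ - G (π σ)| < ε / 2 := hσ
      have h2 : 0 ≤ 2 * B * Real.exp (κ * (M - η)) := by positivity
      nlinarith [hEpos σ]
    · have h1 : |G σ - G (π σ)| ≤ 2 * B := (abs_sub _ _).trans (by linarith [hB' σ, hB' (π σ)])
      have h2 : E σ ≤ Real.exp (κ * (M - η)) :=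
        Real.exp_le_exp.2 (mul_le_mul_of_nonneg_left (hKη σ hσ) hκ0)
      have h3 : 0 ≤ ε / 2 * E σ := by positivity
      calc |G σ - G (π σ)| * E σ ≤ 2 * B * Real.exp (κ * (M - η)) :=
            mul_le_mul h1 h2 (hEpos σ).le (by positivity)
        _ ≤ _ := by linarith
  have hdiff : |(∫ σ, G σ * E σ ∂μ) - c * Z| ≤ ε / 2 * Z + 2 * B * Real.exp (κ * (M - η)) * m := by
    rw [hZ, ← hind κ, ← integral_sub hGEi hGπEi]
    calc |∫ σ, (G σ * E σ - G (π σ) * E σ) ∂μ| ≤ ∫ σ, |G σ * E σ - G (π σ) * E σ| ∂μ :=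
          abs_integral_le_integral_abs
      _ ≤ ∫ σ, (ε / 2 * E σ + 2 * B * Real.exp (κ * (M - η))) ∂μ :=
          integral_mono_of_nonneg (ae_of_all _ fun _ => abs_nonneg _)
            ((hEi.const_mul _).add (integrable_const _)) (ae_of_all _ hpt)
      _ = ε / 2 * Z + 2 * B * Real.exp (κ * (M - η)) * m := by
          rw [integral_add (hEi.const_mul _) (integrable_const _), integral_const_mul, integral_const,
            smul_eq_mul, hm]
          ring
  -- the exponentially small term is `< ε/2 · Z`
  have hsmallZ : 2 * B * Real.exp (κ * (M - η)) * m < ε / 2 * Z := by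
    have hs0 : 0 ≤ 2 * B * m / μ.real W * Real.exp (-(κ * (η / 2))) := by positivity
    have hexp : Real.exp (κ * (M - η)) = Real.exp (-(κ * (η / 2))) * Real.exp (κ * (M - η / 2)) := by
      rw [← Real.exp_add]; ring_nf
    have hrew : 2 * B * Real.exp (κ * (M - η)) * m =
        (2 * B * m / μ.real W * Real.exp (-(κ * (η / 2)))) * (Real.exp (κ * (M - η / 2)) * μ.real W) := by
      rw [hexp]; field_simp
    rw [hrew]
    exact lt_of_le_of_lt (mul_le_mul_of_nonneg_left hZlow hs0) (mul_lt_mul_of_pos_right hsmall hZpos)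
  -- conclude
  rw [Real.dist_eq]
  have hkey : |(∫ σ, G σ * E σ ∂μ) / Z - c| = |(∫ σ, G σ * E σ ∂μ) - c * Z| / Z := by
    have h : (∫ σ, G σ * E σ ∂μ) / Z - c = ((∫ σ, G σ * E σ ∂μ) - c * Z) / Z := by
      field_simp
    rw [h, abs_div, abs_of_pos hZpos]
  rw [hkey, div_lt_iff₀ hZpos]
  calc |(∫ σ, G σ * E σ ∂μ) - c * Z| ≤ ε / 2 * Z + 2 * B * Real.exp (κ * (M - η)) * m := hdiff
    _ < ε / 2 * Z + ε / 2 * Z := by linarith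
    _ = ε * Z := by ring

end LaplaceFreezing

/-! ### 2. Independence of disjoint blocks of links under the product Haar measure -/

namespace AbelianStack

open ThermalHiggs ThermalCentre Z2Thermal AbelianHiggs

variable {d L₀ L : ℕ} {Γ : Type*} [CommGroup Γ] [TopologicalSpace Γ] [IsTopologicalGroup Γ]
  [CompactSpace Γ] [SecondCountableTopology Γ] [MeasurableSpace Γ] [BorelSpace Γ]

/-- Extension of a block configuration by the identity off the block. [folklore] -/
private def blockExtend (S : Finset (Link d L₀ L)) (ψ : S → Γ) : Config d L₀ L Γ :=
  fun e => if h : e ∈ S then ψ ⟨e, h⟩ else 1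

omit [TopologicalSpace Γ] [IsTopologicalGroup Γ] [CompactSpace Γ] [SecondCountableTopology Γ] [BorelSpace Γ] in
/-- Block extension is measurable. [folklore] -/
private theorem measurable_blockExtend (S : Finset (Link d L₀ L)) : Measurable (blockExtend (Γ := Γ) S) := by
  refine measurable_pi_lambda _ fun e => ?_
  by_cases h : e ∈ S
  · simp only [blockExtend, dif_pos h]; exact measurable_pi_apply _
  · simp only [blockExtend, dif_neg h]; exact measurable_const

omit [SecondCountableTopology Γ] in
/-- The link variables are independent under the a-priori product Haar measure. [folklore] -/
private theorem iIndepFun_apply [NeZero L₀] [NeZero L] :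
    iIndepFun (fun (e : Link d L₀ L) (σ : Config d L₀ L Γ) => σ e) (haar d L₀ L Γ) := by
  unfold haar
  exact iIndepFun_pi (μ := fun _ : Link d L₀ L => haarProbability Γ) (X := fun (_ : Link d L₀ L) (g : Γ) => g)
    fun _ => aemeasurable_id'

/-- **Independence of disjoint blocks of links**: if `F` depends only on the links in `S` and `G`
only on the links in `T`, `S ∩ T = ∅`, both continuous with values in `ℝ` or `ℂ`, then
`∫ F·G ∏dσ = ∫ F ∏dσ · ∫ G ∏dσ` for the product Haar measure. [folklore] -/
private theorem integral_mul_eq_mul_of_dependsOn [NeZero L₀] [NeZero L] {𝕜 : Type*} [RCLike 𝕜]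
    (S T : Finset (Link d L₀ L)) (hST : Disjoint S T) {F G : Config d L₀ L Γ → 𝕜}
    (hF : Continuous F) (hG : Continuous G)
    (hFdep : ∀ σ σ' : Config d L₀ L Γ, (∀ e ∈ S, σ e = σ' e) → F σ = F σ')
    (hGdep : ∀ σ σ' : Config d L₀ L Γ, (∀ e ∈ T, σ e = σ' e) → G σ = G σ') :
    ∫ σ, F σ * G σ ∂haar d L₀ L Γ = (∫ σ, F σ ∂haar d L₀ L Γ) * ∫ σ, G σ ∂haar d L₀ L Γ := by
  classical
  set F' : (S → Γ) → 𝕜 := fun ψ => F (blockExtend S ψ) with hF'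
  set G' : (T → Γ) → 𝕜 := fun ψ => G (blockExtend T ψ) with hG'
  have hFF : F = F' ∘ fun (σ : Config d L₀ L Γ) (i : S) => σ i := by
    funext σ
    exact hFdep σ _ fun e he => by simp [blockExtend, he]
  have hGG : G = G' ∘ fun (σ : Config d L₀ L Γ) (j : T) => σ j := by
    funext σ
    exact hGdep σ _ fun e he => by simp [blockExtend, he]
  have hind : IndepFun (fun (σ : Config d L₀ L Γ) (i : S) => σ i) (fun σ (j : T) => σ j)
      (haar d L₀ L Γ) :=
    iIndepFun_apply.indepFun_finset S T hST fun e => measurable_pi_apply e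
  have hmF' : Measurable F' := hF.measurable.comp (measurable_blockExtend S)
  have hmG' : Measurable G' := hG.measurable.comp (measurable_blockExtend T)
  have hind' := hind.comp hmF' hmG'
  have h1 : AEStronglyMeasurable (F' ∘ fun (σ : Config d L₀ L Γ) (i : S) => σ i) (haar d L₀ L Γ) := by
    rw [← hFF]; exact hF.aestronglyMeasurable
  have h2 : AEStronglyMeasurable (G' ∘ fun (σ : Config d L₀ L Γ) (j : T) => σ j) (haar d L₀ L Γ) := by
    rw [← hGG]; exact hG.aestronglyMeasurable
  rw [hFF, hGG]
  exact hind'.integral_fun_mul_eq_mul_integral h1 h2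

/-! ### 3. Freezing the space-like links: the `κs → ∞` (equivalently `J_M → ∞`) limit -/

variable (φ : Γ →ₜ* Circle)

/-- **Freezing**: the configuration with all SPACE-like links set to the identity (the time-like
links kept). [cite: BorgsSeiler1983, §IV (pp. 358–359)] -/
def freeze (σ : Config d L₀ L Γ) : Config d L₀ L Γ := fun e => if e.2 = none then σ e else 1

omit [TopologicalSpace Γ] [IsTopologicalGroup Γ] [CompactSpace Γ] [SecondCountableTopology Γ]
  [MeasurableSpace Γ] [BorelSpace Γ] in
/-- Freezing keeps the time-like links. [cite: BorgsSeiler1983, §IV (pp. 358–359)] -/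
@[simp] theorem freeze_apply_none (σ : Config d L₀ L Γ) (x : FiniteTemperature.Site d L₀ L) :
    freeze σ (x, none) = σ (x, none) := by simp [freeze]

omit [TopologicalSpace Γ] [IsTopologicalGroup Γ] [CompactSpace Γ] [SecondCountableTopology Γ]
  [MeasurableSpace Γ] [BorelSpace Γ] in
/-- Freezing sets the space-like links to the identity. [cite: BorgsSeiler1983, §IV (pp. 358–359)] -/
@[simp] theorem freeze_apply_some (σ : Config d L₀ L Γ) (x : FiniteTemperature.Site d L₀ L) (i : Fin d) :
    freeze σ (x, some i) = 1 := by simp [freeze]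

omit [IsTopologicalGroup Γ] [CompactSpace Γ] [SecondCountableTopology Γ] [MeasurableSpace Γ] [BorelSpace Γ] in
/-- Freezing is continuous. [folklore] -/
private theorem continuous_freeze : Continuous (freeze : Config d L₀ L Γ → Config d L₀ L Γ) := by
  refine continuous_pi fun e => ?_
  by_cases h : e.2 = none
  · simp only [freeze, h, if_true]; exact continuous_apply e
  · simp only [freeze, h, if_false]; exact continuous_const

omit [TopologicalSpace Γ] [IsTopologicalGroup Γ] [CompactSpace Γ] [SecondCountableTopology Γ]
  [MeasurableSpace Γ] [BorelSpace Γ] in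
/-- `freeze σ` depends only on the time-like links. [folklore] -/
private theorem freeze_dependsOn [NeZero L₀] [NeZero L] {σ σ' : Config d L₀ L Γ}
    (h : ∀ e ∈ (Finset.univ.filter fun e : Link d L₀ L => e.2 = none), σ e = σ' e) :
    freeze σ = freeze σ' := by
  funext e
  by_cases he : e.2 = none
  · simp only [freeze, he, if_true]; exact h e (by simp [he])
  · simp only [freeze, he, if_false]

/-- The **space-like field** `Ψ(σ) = Σ_{space-like ℓ} Re φ(σ_ℓ)` — the unitary-gauge Higgs term on
the space-like links at unit hopping parameter. [cite: BorgsSeiler1983, §IV (pp. 358–359)] -/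
def spaceField [NeZero L₀] [NeZero L] (σ : Config d L₀ L Γ) : ℝ :=
  ∑ p : FiniteTemperature.Site d L₀ L × Fin d, ((φ (σ (p.1, some p.2)) : Circle) : ℂ).re

omit [IsTopologicalGroup Γ] [CompactSpace Γ] [SecondCountableTopology Γ] [MeasurableSpace Γ] [BorelSpace Γ] in
/-- `Ψ` is continuous. [folklore] -/
private theorem continuous_spaceField [NeZero L₀] [NeZero L] :
    Continuous (spaceField (d := d) (L₀ := L₀) (L := L) φ) := by
  unfold spaceField
  refine continuous_finsetSum _ fun p _ => ?_
  exact Complex.continuous_re.comp (continuous_subtype_val.comp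
    ((map_continuous φ).comp (continuous_apply _)))

omit [IsTopologicalGroup Γ] [CompactSpace Γ] [SecondCountableTopology Γ] [MeasurableSpace Γ] [BorelSpace Γ] in
/-- `Ψ` depends only on the space-like links. [folklore] -/
private theorem spaceField_dependsOn [NeZero L₀] [NeZero L] {σ σ' : Config d L₀ L Γ}
    (h : ∀ e ∈ (Finset.univ.filter fun e : Link d L₀ L => ¬ e.2 = none), σ e = σ' e) :
    spaceField φ σ = spaceField φ σ' := by
  unfold spaceField
  refine Finset.sum_congr rfl fun p _ => ?_
  rw [h (p.1, some p.2) (by simp)]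

omit [IsTopologicalGroup Γ] [CompactSpace Γ] [SecondCountableTopology Γ] [MeasurableSpace Γ] [BorelSpace Γ] in
/-- At `κt = 0` the matter term is `κs · Ψ`. [cite: MarraMiraclesole1979, §1 eq. (3)] -/
theorem matterTerm_charRep_zero [NeZero L₀] [NeZero L] (κs : ℝ) (σ : Config d L₀ L Γ) :
    matterTerm (charRep φ) 0 κs σ = κs * spaceField φ σ := by
  rw [matterTerm, zero_mul, zero_add, spaceField]
  conv_rhs => rw [Fintype.sum_prod_type]
  simp only [trace_charRep_re]

omit [IsTopologicalGroup Γ] [CompactSpace Γ] [SecondCountableTopology Γ] [MeasurableSpace Γ] [BorelSpace Γ] in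
/-- A unit complex number with real part `1` is `1`. [folklore] -/
private theorem circle_eq_one_of_re {z : Circle} (h : ((z : ℂ)).re = 1) : z = 1 := by
  have hn : Complex.normSq (z : ℂ) = 1 := by rw [Complex.normSq_eq_norm_sq, Circle.norm_coe, one_pow]
  rw [Complex.normSq_apply, h] at hn
  have him : ((z : ℂ)).im = 0 := by nlinarith
  exact Circle.ext (Complex.ext (by simpa using h) (by simpa using him))

omit [IsTopologicalGroup Γ] [CompactSpace Γ] [SecondCountableTopology Γ] [MeasurableSpace Γ] [BorelSpace Γ] in
/-- **The maximisers of `Ψ` are the frozen configurations** (faithful `φ`): if `Ψ(σ)` is maximal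
then every space-like link of `σ` is the identity, i.e. `freeze σ = σ` (the support of Ginibre's
limiting measure `σ̄`). [cite: Ginibre1970, §2 Model 2, eqs. (2.23)–(2.24) (p. 322)] -/
theorem freeze_eq_self_of_isMax [NeZero L₀] [NeZero L] (hφ : Function.Injective φ) (σ : Config d L₀ L Γ)
    (h : ∀ τ : Config d L₀ L Γ, spaceField φ τ ≤ spaceField φ σ) : freeze σ = σ := by
  have h1 : spaceField φ (1 : Config d L₀ L Γ) =
      Fintype.card (FiniteTemperature.Site d L₀ L × Fin d) := by
    simp [spaceField]
  have hle : ∀ p : FiniteTemperature.Site d L₀ L × Fin d,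
      ((φ (σ (p.1, some p.2)) : Circle) : ℂ).re ≤ 1 := fun p =>
    (Complex.re_le_norm _).trans_eq (Circle.norm_coe _)
  have hsum : ∑ p : FiniteTemperature.Site d L₀ L × Fin d, (1 - ((φ (σ (p.1, some p.2)) : Circle) : ℂ).re) = 0 := by
    rw [Finset.sum_sub_distrib, Finset.sum_const, Finset.card_univ, nsmul_eq_mul, mul_one]
    have hlow := h 1
    rw [h1] at hlow
    have hup : spaceField φ σ ≤ Fintype.card (FiniteTemperature.Site d L₀ L × Fin d) := by
      unfold spaceField
      calc _ ≤ ∑ _p : FiniteTemperature.Site d L₀ L × Fin d, (1 : ℝ) := Finset.sum_le_sum fun p _ => hle p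
        _ = _ := by simp
    have heq : spaceField φ σ = Fintype.card (FiniteTemperature.Site d L₀ L × Fin d) := le_antisymm hup hlow
    unfold spaceField at heq
    linarith
  have hall := (Finset.sum_eq_zero_iff_of_nonneg fun p _ => sub_nonneg.2 (hle p)).1 hsum
  funext e
  rcases e with ⟨x, _ | i⟩
  · simp [freeze]
  · simp only [freeze_apply_some]
    have hre : ((φ (σ (x, some i)) : Circle) : ℂ).re = 1 := by
      have := hall (x, i) (Finset.mem_univ _); linarith
    have hφ1 : φ (σ (x, some i)) = 1 := circle_eq_one_of_re hre
    exact (hφ (by rw [hφ1, map_one])).symm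

section Frozen

variable [NeZero L₀] [NeZero L]

/-- The **frozen expectation** `⟨F⟩^{frozen}_{J_E}`: the finite-temperature `Γ` theory with all
space-like links set to the identity (Borgs–Seiler's `J_M → ∞` system: "all the space-like
plaquettes freeze … a stack of `L₀` copies" of one layer). [cite: BorgsSeiler1983, §IV (pp. 358–359)] -/
def frozenExpectation (JE JM : ℝ) (F : Config d L₀ L Γ → ℝ) : ℝ :=
  (∫ σ, F (freeze σ) * weight (charRep φ) JE JM (freeze σ) ∂haar d L₀ L Γ) /
    ∫ σ, weight (charRep φ) JE JM (freeze σ) ∂haar d L₀ L Γ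

omit [SecondCountableTopology Γ] in
/-- The gauge–Higgs expectation at `κt = 0` as a ratio of `Ψ`-tilted integrals. [cite: MarraMiraclesole1979, §1 eq. (3)] -/
theorem higgsExpectation_zero_eq (JE JM κs : ℝ) (F : Config d L₀ L Γ → ℝ) :
    higgsExpectation (charRep φ) JE JM 0 κs F =
      (∫ σ, (F σ * weight (charRep φ) JE JM σ) * Real.exp (κs * spaceField φ σ) ∂haar d L₀ L Γ) /
        ∫ σ, weight (charRep φ) JE JM σ * Real.exp (κs * spaceField φ σ) ∂haar d L₀ L Γ := by
  unfold higgsExpectation higgsWeight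
  simp_rw [matterTerm_charRep_zero, mul_assoc]

/-- ★ **Ginibre's freezing limit on Borgs–Seiler's lattice**: for a faithful character `φ` and every
continuous observable `F`, the gauge–Higgs expectation with space-like hopping `κs` converges, as
`κs → ∞`, to the FROZEN expectation (space-like links set to `1`), at every `J_E, J_M`.
[cite: Ginibre1970, §2 Model 2, eqs. (2.22)–(2.24) (p. 322)] [cite: BorgsSeiler1983, §IV (pp. 358–359)] -/
theorem tendsto_higgsExpectation_frozen (hφ : Function.Injective φ) (JE JM : ℝ)
    {F : Config d L₀ L Γ → ℝ} (hF : Continuous F) :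
    Tendsto (fun κs : ℝ => higgsExpectation (charRep φ) JE JM 0 κs F) atTop
      (𝓝 (frozenExpectation φ JE JM F)) := by
  classical
  haveI : (haar d L₀ L Γ).IsOpenPosMeasure := by unfold haar; infer_instance
  have hw : Continuous fun σ : Config d L₀ L Γ => weight (charRep φ) JE JM σ :=
    continuous_weight (charRep φ) (continuous_charRep φ) JE JM
  have hΨ := continuous_spaceField (d := d) (L₀ := L₀) (L := L) φ
  -- the time-like / space-like blocks
  set T : Finset (Link d L₀ L) := Finset.univ.filter fun e : Link d L₀ L => e.2 = none with hT
  set S : Finset (Link d L₀ L) := Finset.univ.filter fun e : Link d L₀ L => ¬ e.2 = none with hS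
  have hTS : Disjoint T S := by
    rw [Finset.disjoint_left]
    intro e heT heS
    exact (Finset.mem_filter.1 heS).2 (Finset.mem_filter.1 heT).2
  -- independence: `∫ G(freeze σ) e^{κΨ(σ)} = ∫ G ∘ freeze · ∫ e^{κΨ}`
  have hind : ∀ {G : Config d L₀ L Γ → ℝ}, Continuous G → ∀ κ : ℝ,
      ∫ σ, G (freeze σ) * Real.exp (κ * spaceField φ σ) ∂haar d L₀ L Γ =
        (∫ σ, G (freeze σ) ∂haar d L₀ L Γ) * ∫ σ, Real.exp (κ * spaceField φ σ) ∂haar d L₀ L Γ := by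
    intro G hG κ
    exact integral_mul_eq_mul_of_dependsOn T S hTS (hG.comp continuous_freeze)
      (Real.continuous_exp.comp (continuous_const.mul hΨ))
      (fun σ σ' h => by rw [freeze_dependsOn h]) (fun σ σ' h => by rw [spaceField_dependsOn φ (σ := σ) (σ' := σ') h])
  have hfix : ∀ σ : Config d L₀ L Γ, (∀ τ, spaceField φ τ ≤ spaceField φ σ) → freeze σ = σ :=
    freeze_eq_self_of_isMax φ hφ
  -- numerator and denominator ratios converge separately
  have hnum := LaplaceFreezing.tendsto_tilted_ratio (haar d L₀ L Γ) hΨ (hF.mul hw) continuous_freeze hfix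
    (c := ∫ σ, F (freeze σ) * weight (charRep φ) JE JM (freeze σ) ∂haar d L₀ L Γ)
    (fun κ => hind (hF.mul hw) κ)
  have hden := LaplaceFreezing.tendsto_tilted_ratio (haar d L₀ L Γ) hΨ hw continuous_freeze hfix
    (c := ∫ σ, weight (charRep φ) JE JM (freeze σ) ∂haar d L₀ L Γ) (fun κ => hind hw κ)
  have hden0 : (∫ σ, weight (charRep φ) JE JM (freeze σ) ∂haar d L₀ L Γ) ≠ 0 :=
    (integral_exp_pos (integrable_of_continuous (Real.continuous_exp.comp
      ((continuous_minusAction (charRep φ) (continuous_charRep φ) JE JM).comp continuous_freeze)))).ne'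
  have hlim := hnum.div hden hden0
  refine hlim.congr' ?_
  filter_upwards [eventually_ge_atTop (0 : ℝ)] with κs _
  have hZ : 0 < ∫ σ, Real.exp (κs * spaceField φ σ) ∂haar d L₀ L Γ :=
    integral_exp_pos (integrable_of_continuous (Real.continuous_exp.comp (continuous_const.mul hΨ)))
  rw [higgsExpectation_zero_eq, Pi.div_apply, div_div_div_cancel_right₀ hZ.ne']
  rfl

/-- ★ **The `J_M → ∞` bound for abelian gauge groups** (Borgs–Seiler §IV p. 359 "implied by
Ginibre's inequalities"): for a compact abelian `Γ` in which every element is a square and a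
faithful character `φ`, the finite-temperature Polyakov two-point function at `(J_E, J_M)`,
`J_E, J_M ≥ 0`, is bounded by the FROZEN one: `G_L^{Γ}(x; J_E, J_M) ≤ ⟨Re χ_x⟩^{frozen}_{J_E}`
(Griffiths II in the space-like hopping `κs`, then `κs → ∞`).
[cite: BorgsSeiler1983, §IV (pp. 358–359)] [cite: Ginibre1970, Prop. 3 with §2 Model 2, eqs. (2.22)–(2.24)] -/
theorem polyakovCorrelation_le_frozen (hΓ : Function.Surjective fun γ : Γ => γ * γ)
    (hφ : Function.Injective φ) {JE JM : ℝ} (hJE : 0 ≤ JE) (hJM : 0 ≤ JM) (x : Fin d → ZMod L) :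
    polyakovCorrelation (L₀ := L₀) (charRep φ) JE JM x ≤
      frozenExpectation φ JE JM (reChar (pairChar (L₀ := L₀) φ x)) := by
  have hlim := tendsto_higgsExpectation_frozen φ hφ JE JM (continuous_reChar (pairChar (L₀ := L₀) φ x))
  refine ge_of_tendsto hlim ?_
  filter_upwards [eventually_ge_atTop (0 : ℝ)] with κs hκs
  rw [← AbelianHiggs.polyakovCorrelation_kappa_zero]
  exact higgsExpectation_reChar_mono φ hΓ hJE hJM le_rfl le_rfl le_rfl le_rfl le_rfl hκs _

end Frozen

/-! ### 4. The frozen system is a stack of `L₀` independent layers -/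

section Layer

variable (d L)

/-- The **layer bond characters** `τ ↦ φ(τ_v τ_{v+e_i}⁻¹)` of ONE spatial layer `(ℤ/L)^d`, indexed by
the forward bonds `(v, i)` — what a time-like plaquette character becomes when its two space-like
links are frozen to the identity. [cite: BorgsSeiler1983, §IV (pp. 358–359)] -/
def layerChar (p : (Fin d → ZMod L) × Fin d) : ((Fin d → ZMod L) → Γ) →ₜ* Circle where
  toFun τ := φ (τ p.1 * (τ (p.1 + Pi.single p.2 1))⁻¹)
  map_one' := by simp
  map_mul' τ τ' := by
    rw [← map_mul]
    congr 1
    simp only [Pi.mul_apply, mul_inv]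
    exact mul_mul_mul_comm _ _ _ _
  continuous_toFun := (map_continuous φ).comp ((continuous_apply _).mul (continuous_apply _).inv)

/-- The **layer pair character** `τ ↦ φ(τ_0 τ_x⁻¹)` (one time-slice of the Polyakov pair). [cite: BorgsSeiler1983, §IV (pp. 358–359)] -/
def layerPair (x : Fin d → ZMod L) : ((Fin d → ZMod L) → Γ) →ₜ* Circle where
  toFun τ := φ (τ 0 * (τ x)⁻¹)
  map_one' := by simp
  map_mul' τ τ' := by
    rw [← map_mul]
    congr 1
    simp only [Pi.mul_apply, mul_inv]
    exact mul_mul_mul_comm _ _ _ _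
  continuous_toFun := (map_continuous φ).comp ((continuous_apply _).mul (continuous_apply _).inv)

omit [CompactSpace Γ] [SecondCountableTopology Γ] [MeasurableSpace Γ] [BorelSpace Γ] in
/-- `layerChar φ (v,i) τ = φ(τ_v τ_{v+e_i}⁻¹)`. [cite: BorgsSeiler1983, §IV (pp. 358–359)] -/
@[simp] theorem layerChar_apply (p : (Fin d → ZMod L) × Fin d) (τ : (Fin d → ZMod L) → Γ) :
    layerChar d L φ p τ = φ (τ p.1 * (τ (p.1 + Pi.single p.2 1))⁻¹) := rfl

omit [CompactSpace Γ] [SecondCountableTopology Γ] [MeasurableSpace Γ] [BorelSpace Γ] in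
/-- `layerPair φ x τ = φ(τ_0 τ_x⁻¹)`. [cite: BorgsSeiler1983, §IV (pp. 358–359)] -/
@[simp] theorem layerPair_apply (x : Fin d → ZMod L) (τ : (Fin d → ZMod L) → Γ) :
    layerPair d L φ x τ = φ (τ 0 * (τ x)⁻¹) := rfl

variable (Γ) in
/-- The a-priori measure of one layer: product Haar measure over the spatial sites. [folklore] -/
def layerHaar [NeZero L] : Measure ((Fin d → ZMod L) → Γ) :=
  Measure.pi fun _ : Fin d → ZMod L => haarProbability Γ

/-- The **one-layer two-point function** `⟨Re φ(τ_0 τ_x⁻¹)⟩_{(ℤ/L)^d, J_E}` of the generalised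
plane-rotator (Ginibre) model with bond characters `layerChar` at coupling `J_E` — for `Γ = U(1)`,
`φ = id` the classical XY model on the torus `(ℤ/L)^d` (`layerTwoPoint_u1_eq_twoPoint`). [cite: BorgsSeiler1983, §IV (pp. 358–359)] -/
def layerTwoPoint [NeZero L] (JE : ℝ) (x : Fin d → ZMod L) : ℝ :=
  ginibreExpect (layerHaar d L Γ) (layerChar d L φ) (fun _ => JE) (reChar (layerPair d L φ x))

variable {d L}

/-- The time slice `t` of the time-like links: `v ↦ σ((t, v), time)`. [folklore] -/
def slice (t : ZMod L₀) (σ : Config d L₀ L Γ) : (Fin d → ZMod L) → Γ := fun v => σ ((t, v), none)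

omit [CommGroup Γ] [IsTopologicalGroup Γ] [CompactSpace Γ] [SecondCountableTopology Γ] [MeasurableSpace Γ]
  [BorelSpace Γ] in
/-- Slices are continuous. [folklore] -/
private theorem continuous_slice (t : ZMod L₀) : Continuous (slice (d := d) (L := L) (Γ := Γ) t) :=
  continuous_pi fun _ => continuous_apply _

/-- The block of time-like links in the slice `t`. [folklore] -/
private def sliceBlock [NeZero L₀] [NeZero L] (t : ZMod L₀) : Finset (Link d L₀ L) :=
  Finset.univ.filter fun e => e.2 = none ∧ e.1.1 = t

omit [CommGroup Γ] [TopologicalSpace Γ] [IsTopologicalGroup Γ] [CompactSpace Γ] [SecondCountableTopology Γ]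
  [MeasurableSpace Γ] [BorelSpace Γ] in
/-- A slice depends only on its block of time-like links. [folklore] -/
private theorem slice_dependsOn [NeZero L₀] [NeZero L] (t : ZMod L₀) {σ σ' : Config d L₀ L Γ}
    (h : ∀ e ∈ sliceBlock (d := d) (L₀ := L₀) (L := L) t, σ e = σ' e) : slice t σ = slice t σ' := by
  funext v
  exact h (((t, v), none)) (by simp [sliceBlock])

/-! #### The frozen action, weight and Polyakov pair, slice by slice -/

omit [TopologicalSpace Γ] [IsTopologicalGroup Γ] [CompactSpace Γ] [SecondCountableTopology Γ]
  [MeasurableSpace Γ] [BorelSpace Γ] in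
/-- A frozen time-like plaquette is the layer bond variable `σ(x,time) σ(x+e_i,time)⁻¹`. [cite: BorgsSeiler1983, §IV (pp. 358–359)] -/
private theorem plaquette_freeze_time (σ : Config d L₀ L Γ) (x : FiniteTemperature.Site d L₀ L) (i : Fin d) :
    plaquette (freeze σ) x none (some i) = σ (x, none) * (σ (x.shift (some i), none))⁻¹ := by
  simp only [plaquette, freeze_apply_none, freeze_apply_some, mul_one, inv_one]

omit [TopologicalSpace Γ] [IsTopologicalGroup Γ] [CompactSpace Γ] [SecondCountableTopology Γ]
  [MeasurableSpace Γ] [BorelSpace Γ] in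
/-- A frozen space-like plaquette is trivial. [cite: BorgsSeiler1983, §IV (pp. 358–359)] -/
private theorem plaquette_freeze_space (σ : Config d L₀ L Γ) (x : FiniteTemperature.Site d L₀ L) (i j : Fin d) :
    plaquette (freeze σ) x (some i) (some j) = 1 := by
  simp only [plaquette, freeze_apply_some, mul_one, inv_one]

/-- The number of space-like plaquettes (a constant). [folklore] -/
private def nSpace (d L₀ L : ℕ) [NeZero L₀] [NeZero L] : ℝ :=
  (Fintype.card (FiniteTemperature.Site d L₀ L) : ℝ) * Fintype.card {p : Fin d × Fin d // p.1 < p.2}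

omit [CompactSpace Γ] [SecondCountableTopology Γ] [MeasurableSpace Γ] [BorelSpace Γ] in
/-- **The frozen action is the sum of the layer Hamiltonians** (plus the constant space-like part).
[cite: BorgsSeiler1983, §IV (pp. 358–359)] -/
theorem minusAction_freeze [NeZero L₀] [NeZero L] (JE JM : ℝ) (σ : Config d L₀ L Γ) :
    minusAction (charRep φ) JE JM (freeze σ) =
      ∑ t : ZMod L₀, ginibreHamiltonian (layerChar d L φ) (fun _ => JE) (slice t σ) + JM * nSpace d L₀ L := by
  rw [minusAction]
  congr 1
  · simp only [plaquette_freeze_time, trace_charRep_re, ginibreHamiltonian, reChar, layerChar_apply,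
      Fintype.sum_prod_type, Finset.mul_sum, slice]
    rfl
  · have h1 : ∀ (x : FiniteTemperature.Site d L₀ L) (p : {p : Fin d × Fin d // p.1 < p.2}),
        (charRep φ (plaquette (freeze σ) x (some p.1.1) (some p.1.2))).trace.re = 1 := fun x p => by
      rw [plaquette_freeze_space, map_one, Matrix.trace_one, Fintype.card_fin, Nat.cast_one, Complex.one_re]
    simp only [h1, Finset.sum_const, Finset.card_univ, nsmul_eq_mul, mul_one, nSpace]

omit [CompactSpace Γ] [SecondCountableTopology Γ] [MeasurableSpace Γ] [BorelSpace Γ] in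
/-- **The frozen weight factorises over the time slices.** [cite: BorgsSeiler1983, §IV (pp. 358–359)] -/
theorem weight_freeze [NeZero L₀] [NeZero L] (JE JM : ℝ) (σ : Config d L₀ L Γ) :
    weight (charRep φ) JE JM (freeze σ) =
      Real.exp (JM * nSpace d L₀ L) * ∏ t : ZMod L₀, ginibreWeight (layerChar d L φ) (fun _ => JE) (slice t σ) := by
  rw [weight, minusAction_freeze, Real.exp_add, Real.exp_sum, mul_comm]
  rfl

/-- `((∏ f) : ℂ) = ∏ (f : ℂ)` for `Circle`-valued products. [folklore] -/
private theorem coe_prod' {ι : Type*} (s : Finset ι) (f : ι → Circle) :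
    ((∏ i ∈ s, f i : Circle) : ℂ) = ∏ i ∈ s, ((f i : Circle) : ℂ) :=
  map_prod Circle.coeHom f s

omit [CompactSpace Γ] [SecondCountableTopology Γ] [MeasurableSpace Γ] [BorelSpace Γ] in
/-- **The frozen Polyakov pair is the product of the layer pair variables over the slices.**
[cite: BorgsSeiler1983, §IV (pp. 358–359)] -/
theorem coe_pairChar_freeze [NeZero L₀] (x : Fin d → ZMod L) (σ : Config d L₀ L Γ) :
    ((pairChar (L₀ := L₀) φ x (freeze σ) : Circle) : ℂ) =
      ∏ t : ZMod L₀, ((layerPair d L φ x (slice t σ) : Circle) : ℂ) := by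
  rw [coe_pairChar, polyakovLine_eq_prod, polyakovLine_eq_prod, map_prod, map_prod, coe_prod', coe_prod',
    map_prod (starRingEnd ℂ), ← Finset.prod_mul_distrib]
  refine Finset.prod_congr rfl fun t _ => ?_
  simp only [freeze_apply_none, layerPair_apply, map_mul, map_inv, Circle.coe_mul, Circle.coe_inv_eq_conj, slice]

/-! #### Integrals of slice products are products of layer integrals -/

variable [NeZero L₀] [NeZero L]

omit [SecondCountableTopology Γ] in
/-- The slice map pushes the a-priori measure forward to the layer measure. [folklore] -/
private theorem map_slice (t : ZMod L₀) : (haar d L₀ L Γ).map (slice t) = layerHaar d L Γ := by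
  unfold haar layerHaar slice
  exact pi_map_comp_injective (haarProbability Γ) (τ := fun v : Fin d → ZMod L => (((t, v) : FiniteTemperature.Site d L₀ L), (none : Dir d)))
    fun v w h => by simpa using h

/-- **Change of variables to the layer**: `∫ g(slice_t σ) ∏dσ = ∫ g dτ`. [folklore] -/
private theorem integral_comp_slice {E : Type*} [NormedAddCommGroup E] [NormedSpace ℝ E] (t : ZMod L₀)
    {g : ((Fin d → ZMod L) → Γ) → E} (hg : Continuous g) :
    ∫ σ, g (slice t σ) ∂haar d L₀ L Γ = ∫ τ, g τ ∂layerHaar d L Γ := by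
  rw [← map_slice (d := d) (L₀ := L₀) (L := L) (Γ := Γ) t,
    integral_map (continuous_slice t).measurable.aemeasurable hg.aestronglyMeasurable]

/-- **Independence of the slices**: the integral of a product of slice observables is the product of
the layer integrals. [folklore] -/
private theorem integral_prod_slice {𝕜 : Type*} [RCLike 𝕜] (f : ZMod L₀ → ((Fin d → ZMod L) → Γ) → 𝕜)
    (hf : ∀ t, Continuous (f t)) (s : Finset (ZMod L₀)) :
    ∫ σ, ∏ t ∈ s, f t (slice t σ) ∂haar d L₀ L Γ = ∏ t ∈ s, ∫ τ, f t τ ∂layerHaar d L Γ := by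
  classical
  induction s using Finset.induction_on with
  | empty => simp
  | insert a s ha ih =>
    rw [Finset.prod_insert ha, ← ih, ← integral_comp_slice a (hf a)]
    simp_rw [Finset.prod_insert ha]
    refine integral_mul_eq_mul_of_dependsOn (sliceBlock a) (s.biUnion sliceBlock) ?_
      ((hf a).comp (continuous_slice a)) (continuous_finsetProd _ fun t _ => (hf t).comp (continuous_slice t))
      (fun σ σ' h => by rw [slice_dependsOn a h]) (fun σ σ' h => ?_)
    · rw [Finset.disjoint_biUnion_right]
      intro t ht
      rw [Finset.disjoint_left]
      rintro e he he'
      have h1 := (Finset.mem_filter.1 he).2.2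
      have h2 := (Finset.mem_filter.1 he').2.2
      rw [← h2, h1] at ht
      exact ha ht
    · refine Finset.prod_congr rfl fun t ht => ?_
      rw [slice_dependsOn t fun e he => h e (Finset.mem_biUnion.2 ⟨t, ht, he⟩)]

/-! #### The layer integrals: reality of the complex pair integral -/

/-- Inversion `τ ↦ τ⁻¹` leaves the layer weight invariant and conjugates the pair variable, so the
complex pair integral is real. [folklore] -/
private theorem integral_layerPair_mul_weight (JE : ℝ) (x : Fin d → ZMod L) :
    ∫ τ, ((layerPair d L φ x τ : Circle) : ℂ) * (ginibreWeight (layerChar d L φ) (fun _ => JE) τ : ℂ) ∂layerHaar d L Γ =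
      ((∫ τ, reChar (layerPair d L φ x) τ * ginibreWeight (layerChar d L φ) (fun _ => JE) τ ∂layerHaar d L Γ : ℝ) : ℂ) := by
  haveI : (haarProbability Γ).IsInvInvariant := by unfold haarProbability; infer_instance
  haveI : (layerHaar d L Γ).IsInvInvariant := by unfold layerHaar; infer_instance
  haveI : IsFiniteMeasure (layerHaar d L Γ) := by unfold layerHaar; infer_instance
  set w : ((Fin d → ZMod L) → Γ) → ℝ := ginibreWeight (layerChar d L φ) (fun _ => JE) with hw
  set I : ℂ := ∫ τ, ((layerPair d L φ x τ : Circle) : ℂ) * (w τ : ℂ) ∂layerHaar d L Γ with hI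
  have hzc : Continuous fun τ : (Fin d → ZMod L) → Γ => ((layerPair d L φ x τ : Circle) : ℂ) :=
    continuous_subtype_val.comp (map_continuous _)
  have hcont : Continuous fun τ : (Fin d → ZMod L) → Γ => ((layerPair d L φ x τ : Circle) : ℂ) * (w τ : ℂ) :=
    hzc.mul (Complex.continuous_ofReal.comp (continuous_ginibreWeight _ _))
  have hint : Integrable (fun τ : (Fin d → ZMod L) → Γ => ((layerPair d L φ x τ : Circle) : ℂ) * (w τ : ℂ))
      (layerHaar d L Γ) := integrable_of_continuous_of_isFiniteMeasure _ hcont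
  have hwinv : ∀ τ, w τ⁻¹ = w τ := fun τ => by
    simp only [hw, ginibreWeight, ginibreHamiltonian, reChar, map_inv, Circle.coe_inv_eq_conj, Complex.conj_re]
  have hconj : conj I = I := by
    rw [hI, ← integral_conj, ← integral_inv_eq_self
      (fun τ => ((layerPair d L φ x τ : Circle) : ℂ) * (w τ : ℂ)) (layerHaar d L Γ)]
    refine integral_congr_ae (ae_of_all _ fun τ => ?_)
    simp only [map_mul, Complex.conj_ofReal, map_inv, Circle.coe_inv_eq_conj, hwinv]
  have hre : I.re = ∫ τ, reChar (layerPair d L φ x) τ * w τ ∂layerHaar d L Γ := by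
    have h := integral_re hint
    simp only [RCLike.re_to_complex] at h
    rw [hI, ← h]
    refine integral_congr_ae (ae_of_all _ fun τ => ?_)
    simp only [Complex.mul_re, Complex.ofReal_re, Complex.ofReal_im, mul_zero, sub_zero, reChar]
  rw [← hre]
  exact (Complex.conj_eq_iff_re.1 hconj).symm

/-- ★ **The frozen two-point function is the `L₀`-th power of the one-layer two-point function**:
`⟨Re χ_x⟩^{frozen}_{J_E} = (⟨Re φ(τ_0 τ_x⁻¹)⟩_{(ℤ/L)^d, J_E})^{L₀}` — "a stack of `L₀` copies" of
independent layers. [cite: BorgsSeiler1983, §IV (pp. 358–359)] -/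
theorem frozenExpectation_pairChar (JE JM : ℝ) (x : Fin d → ZMod L) :
    frozenExpectation φ JE JM (reChar (pairChar (L₀ := L₀) φ x)) = layerTwoPoint d L φ JE x ^ L₀ := by
  haveI : IsFiniteMeasure (layerHaar d L Γ) := by unfold layerHaar; infer_instance
  set w : ((Fin d → ZMod L) → Γ) → ℝ := ginibreWeight (layerChar d L φ) (fun _ => JE) with hw
  set z : ((Fin d → ZMod L) → Γ) → ℂ := fun τ => ((layerPair d L φ x τ : Circle) : ℂ) with hz
  set C : ℝ := Real.exp (JM * nSpace d L₀ L) with hC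
  have hwc : Continuous w := continuous_ginibreWeight _ _
  have hzc : Continuous z := continuous_subtype_val.comp (map_continuous _)
  -- denominator
  have hden : ∫ σ, weight (charRep φ) JE JM (freeze σ) ∂haar d L₀ L Γ = C * (∫ τ, w τ ∂layerHaar d L Γ) ^ L₀ := by
    simp_rw [weight_freeze]
    rw [integral_const_mul, integral_prod_slice (𝕜 := ℝ) (fun _ => w) (fun _ => hwc), Finset.prod_const,
      Finset.card_univ, ZMod.card]
  -- numerator
  have hnumC : ∫ σ, (∏ t : ZMod L₀, z (slice t σ)) * ((∏ t : ZMod L₀, w (slice t σ) : ℝ) : ℂ) ∂haar d L₀ L Γ =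
      (((∫ τ, reChar (layerPair d L φ x) τ * w τ ∂layerHaar d L Γ) ^ L₀ : ℝ) : ℂ) := by
    have hpt : ∀ σ : Config d L₀ L Γ, (∏ t : ZMod L₀, z (slice t σ)) * ((∏ t : ZMod L₀, w (slice t σ) : ℝ) : ℂ) =
        ∏ t : ZMod L₀, (z (slice t σ) * (w (slice t σ) : ℂ)) := by
      intro σ; push_cast; rw [Finset.prod_mul_distrib]
    simp_rw [hpt]
    rw [integral_prod_slice (𝕜 := ℂ) (fun _ τ => z τ * (w τ : ℂ)) (fun _ => hzc.mul (Complex.continuous_ofReal.comp hwc)),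
      Finset.prod_const, Finset.card_univ, ZMod.card, integral_layerPair_mul_weight]
    push_cast; rfl
  have hnum : ∫ σ, reChar (pairChar (L₀ := L₀) φ x) (freeze σ) * weight (charRep φ) JE JM (freeze σ) ∂haar d L₀ L Γ =
      C * (∫ τ, reChar (layerPair d L φ x) τ * w τ ∂layerHaar d L Γ) ^ L₀ := by
    have hint : Integrable (fun σ : Config d L₀ L Γ =>
        (∏ t : ZMod L₀, z (slice t σ)) * ((∏ t : ZMod L₀, w (slice t σ) : ℝ) : ℂ)) (haar d L₀ L Γ) := by
      refine integrable_of_continuous_complex (Continuous.mul ?_ ?_)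
      · exact continuous_finsetProd _ fun t _ => hzc.comp (continuous_slice t)
      · exact Complex.continuous_ofReal.comp (continuous_finsetProd _ fun t _ => hwc.comp (continuous_slice t))
    have h := integral_re hint
    simp only [RCLike.re_to_complex] at h
    rw [hnumC, Complex.ofReal_re] at h
    calc ∫ σ, reChar (pairChar (L₀ := L₀) φ x) (freeze σ) * weight (charRep φ) JE JM (freeze σ) ∂haar d L₀ L Γ
        = ∫ σ, C * ((∏ t : ZMod L₀, z (slice t σ)) * ((∏ t : ZMod L₀, w (slice t σ) : ℝ) : ℂ)).re ∂haar d L₀ L Γ := by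
          refine integral_congr_ae (ae_of_all _ fun σ => ?_)
          dsimp only
          rw [show reChar (pairChar (L₀ := L₀) φ x) (freeze σ) = ((pairChar (L₀ := L₀) φ x (freeze σ) : Circle) : ℂ).re
            from rfl, coe_pairChar_freeze, weight_freeze, Complex.re_mul_ofReal]
          simp only [hz, hw, hC]
          ring
      _ = C * (∫ τ, reChar (layerPair d L φ x) τ * w τ ∂layerHaar d L Γ) ^ L₀ := by
          rw [integral_const_mul, h]
  -- assemble
  rw [frozenExpectation, hnum, hden, layerTwoPoint, ginibreExpect, mul_div_mul_left _ _ (Real.exp_pos _).ne',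
    ← div_pow]

end Layer

end AbelianStack

/-! ### 5. `U(1)`: the layer is the classical XY model on the torus `(ℤ/L)^d`; the Aizenman–Simon window -/

section U1

open PlaneRotator

variable {d L₀ L : ℕ}

/-- Every element of `U(1)` is a square. [folklore] -/
private theorem surjective_mul_self_circle : Function.Surjective fun ψ : Circle => ψ * ψ := fun θ =>
  ⟨Circle.exp (Complex.arg (θ : ℂ) / 2), by
    show Circle.exp _ * Circle.exp _ = θ
    rw [← Circle.exp_add, add_halves, Circle.exp_arg]⟩

/-- `ContinuousMonoidHom.id` is the identity. [folklore] -/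
private theorem id_apply' (z : Circle) : ContinuousMonoidHom.id Circle z = z := rfl

/-- **For `U(1)` (`φ = id`) the layer model IS the nearest-neighbour plane rotator on the torus
`(ℤ/L)^d`** (tree `torusXY d L`, one bond `(z, i) : z → z + e_i` per site and direction, coupling `K`):
`⟨Re(τ_0 τ_x⁻¹)⟩^{layer}_{K} = ⟨cos(θ_x − θ_0)⟩^{torusXY}_{K,L}`. [cite: BorgsSeiler1983, §IV (pp. 358–359)] -/
theorem layerTwoPoint_u1_eq_torusXY [NeZero L] (K : ℝ) (x : TorusSite d L) :
    AbelianStack.layerTwoPoint d L (ContinuousMonoidHom.id Circle) K x =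
      (torusXY d L).expectJ (fun _ => K) (cosDiff x 0) := by
  unfold AbelianStack.layerTwoPoint BondSystem.expectJ ginibreExpect
  have hμ : AbelianStack.layerHaar d L Circle = torusHaar (TorusSite d L) := rfl
  have hχ : ∀ (p : TorusSite d L × Fin d) (θ : TorusSite d L → Circle),
      reChar (AbelianStack.layerChar d L (ContinuousMonoidHom.id Circle) p) θ = reChar ((torusXY d L).bondChar p) θ := by
    intro p θ
    have h : ((AbelianStack.layerChar d L (ContinuousMonoidHom.id Circle) p θ : Circle) : ℂ) =
        conj ((((torusXY d L).bondChar p θ : Circle)) : ℂ) := by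
      simp only [AbelianStack.layerChar_apply, id_apply', BondSystem.bondChar, diffChar_apply, torusXY,
        Circle.coe_mul, Circle.coe_inv_eq_conj, map_mul, Complex.conj_conj]
    rw [reChar, reChar, h, Complex.conj_re]
  have hw : ∀ θ : TorusSite d L → Circle,
      ginibreWeight (AbelianStack.layerChar d L (ContinuousMonoidHom.id Circle)) (fun _ => K) θ =
        ginibreWeight (torusXY d L).bondChar (fun _ => K) θ := by
    intro θ
    simp only [ginibreWeight, ginibreHamiltonian, hχ]
  have ho : ∀ θ : TorusSite d L → Circle,
      reChar (AbelianStack.layerPair d L (ContinuousMonoidHom.id Circle) x) θ = cosDiff x 0 θ := by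
    intro θ
    rw [reChar, cosDiff, AbelianStack.layerPair_apply, id_apply', Circle.coe_mul, Circle.coe_inv_eq_conj, mul_comm]
  simp_rw [hμ, hw, ho]

/-- ★ **Borgs–Seiler §IV for `U(1)`, as a theorem: the finite-temperature `U(1)` Polyakov two-point
function is dominated by a stack of `L₀` independent XY models on the torus** — for `J_E, J_M ≥ 0`,
every `L₀`, every `L` and every `x`,
`G_L^{U(1)}(x; J_E, J_M) ≤ (⟨cos(θ_0 − θ_x)⟩^{XY}_{(ℤ/L)^d, J_E})^{L₀}` ("the `J_M → ∞` limit … all the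
space-like plaquettes freeze … a stack of `L₀` copies of XY models … implied by Ginibre's inequalities").
[cite: BorgsSeiler1983, §IV (pp. 358–359)] [cite: Ginibre1970, Prop. 3 with §2 Models 2–3, eqs. (2.22)–(2.24)] -/
theorem u1_polyakovCorrelation_le_torusXY_pow [NeZero L₀] [NeZero L] {JE JM : ℝ} (hJE : 0 ≤ JE)
    (hJM : 0 ≤ JM) (x : TorusSite d L) :
    polyakovCorrelation (L₀ := L₀) u1Rep JE JM x ≤ ((torusXY d L).expectJ (fun _ => JE) (cosDiff x 0)) ^ L₀ := by
  have h := AbelianStack.polyakovCorrelation_le_frozen (d := d) (L₀ := L₀) (L := L) (ContinuousMonoidHom.id Circle)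
    surjective_mul_self_circle (fun a b hab => hab) hJE hJM x
  rwa [AbelianStack.frozenExpectation_pairChar, layerTwoPoint_u1_eq_torusXY, charRep_id_circle] at h

/-- ★ **`U(N)`, every `N`: `|G_L^{U(N)}(x; J_E, J_M)| ≤ N² (⟨cos(θ_0 − θ_x)⟩^{XY}_{(ℤ/L)^d, N J_E})^{L₀}`**
(centre domination `U(N) ⊇ U(1)`, tree `unitaryGroup_abs_polyakovCorrelation_le_u1`, ∘ the XY stack).
[cite: Grosse1988, §4.2.4 eq. (4.134)] [cite: BorgsSeiler1983, §IV (pp. 358–359)] -/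
theorem unitaryGroup_abs_polyakovCorrelation_le_torusXY_pow [NeZero L₀] [NeZero L] {N : ℕ} {JE JM : ℝ}
    (hJE : 0 ≤ JE) (hJM : 0 ≤ JM) (x : TorusSite d L) :
    |polyakovCorrelation (L₀ := L₀) (unitaryFundamentalRep (Fin N) ℂ) JE JM x| ≤
      (N : ℝ) ^ 2 * ((torusXY d L).expectJ (fun _ => (N : ℝ) * JE) (cosDiff x 0)) ^ L₀ :=
  (unitaryGroup_abs_polyakovCorrelation_le_u1 (L₀ := L₀) hJE hJM x).trans
    (mul_le_mul_of_nonneg_left (u1_polyakovCorrelation_le_torusXY_pow (by positivity) (by positivity) x)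
      (by positivity))

/-! #### Exponential decay in the Aizenman–Simon window `K < 2β_c(d)`, uniformly in the volume -/

/-- **The torus XY two-point function decays exponentially for `K < 2β_c(d)`, uniformly in `L`**
(Aizenman–Simon's window via the tree's `exists_nnBoxShellSum_lt_one_of_lt_two_mul_criticalBeta` and
Lieb's box criterion on the torus `torusXY_expectJ_cosDiff_le_pow_nnBoxShellSum`): for `d ≥ 2`,
`0 ≤ K < 2β_c(d)` there are `R ≥ 1` and `θ ∈ [0,1)` with
`0 ≤ ⟨cos(θ_0 − θ_x̄)⟩_{K,L} ≤ θ^{⌊‖x‖_∞/R⌋}` for all `L ≥ 2R + 2` and `x ∈ ℤ^d`, `2‖x‖_∞ ≤ L`.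
[cite: AizenmanSimon1980RotorIsing, eqs. (1)–(2)] [cite: Lieb1980, Theorem 4 and p. 128 (boxes)] -/
theorem exists_uniform_decay_torusXY (hd : 2 ≤ d) {K : ℝ} (hK : 0 ≤ K) (hKc : K < 2 * criticalBeta d) :
    ∃ (R : ℕ) (θ : ℝ), 1 ≤ R ∧ 0 ≤ θ ∧ θ < 1 ∧ ∀ (L : ℕ) [NeZero L], 2 * R + 2 ≤ L →
      ∀ x : Literature.Probability.LatticeModels.Site d, 2 * Site.supNorm x ≤ L →
        0 ≤ (torusXY d L).expectJ (fun _ => K) (cosDiff (Torus.proj L x) 0) ∧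
          (torusXY d L).expectJ (fun _ => K) (cosDiff (Torus.proj L x) 0) ≤ θ ^ (Site.supNorm x / R) := by
  obtain ⟨R, hR, hS⟩ := PlaneRotator.exists_nnBoxShellSum_lt_one_of_lt_two_mul_criticalBeta hd hK hKc
  refine ⟨R, nnBoxShellSum K d R, hR,
    boxShellSum_nonneg (fun _ _ => mul_nonneg (div_nonneg hK zero_le_two)
      (Literature.Barriers.CriticalPhenomena.LongRangeIsing.nnCoupling_nonneg _ _)) R, hS,
    fun L _ hL x hx => ⟨?_, ?_⟩⟩
  · rw [(torusXY d L).expectJ_cosDiff_eq_twoPoint]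
    exact twoPoint_nonneg ((torusXY d L).pairCoupling_nonneg fun _ => hK) _ _
  · have h := torusXY_expectJ_cosDiff_le_pow_nnBoxShellSum hR hL hK (Torus.proj L x) 0
    rwa [torusDist, sub_zero, torusNorm_proj_eq hx] at h

/-- ★ **`U(1)`: temperature-independent confinement in the Aizenman–Simon window.** For `d ≥ 2` and
`0 ≤ J_E < 2β_c(d)` there are `R ≥ 1`, `θ ∈ [0, 1)` such that for EVERY `L₀`, EVERY `J_M ≥ 0`, all
`L ≥ 2R + 2` and `x ∈ ℤ^d` with `2‖x‖_∞ ≤ L`: `0 ≤ G_L^{U(1)}(x̄; J_E, J_M) ≤ θ^{L₀⌊‖x‖_∞/R⌋}`.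
[cite: BorgsSeiler1983, §II.4 (II.55)–(II.56) (p. 343); §IV (pp. 358–359)] [cite: AizenmanSimon1980RotorIsing, eqs. (1)–(2)] -/
theorem u1_polyakovCorrelation_decay_of_lt_two_mul_criticalBeta (hd : 2 ≤ d) {JE : ℝ} (hJE : 0 ≤ JE)
    (hJEc : JE < 2 * criticalBeta d) :
    ∃ (R : ℕ) (θ : ℝ), 1 ≤ R ∧ 0 ≤ θ ∧ θ < 1 ∧
      ∀ (L₀ : ℕ) [NeZero L₀] (JM : ℝ), 0 ≤ JM → ∀ (L : ℕ) [NeZero L], 2 * R + 2 ≤ L →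
        ∀ x : Literature.Probability.LatticeModels.Site d, 2 * Site.supNorm x ≤ L →
          0 ≤ polyakovCorrelation (L₀ := L₀) u1Rep JE JM (Torus.proj L x) ∧
            polyakovCorrelation (L₀ := L₀) u1Rep JE JM (Torus.proj L x) ≤ θ ^ (L₀ * (Site.supNorm x / R)) := by
  obtain ⟨R, θ, hR, hθ0, hθ1, hdec⟩ := exists_uniform_decay_torusXY hd hJE hJEc
  refine ⟨R, θ, hR, hθ0, hθ1, fun L₀ _ JM hJM L _ hL x hx => ⟨u1_polyakovCorrelation_nonneg hJE hJM _, ?_⟩⟩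
  obtain ⟨h0, hle⟩ := hdec L hL x hx
  calc polyakovCorrelation (L₀ := L₀) u1Rep JE JM (Torus.proj L x)
      ≤ ((torusXY d L).expectJ (fun _ => JE) (cosDiff (Torus.proj L x) 0)) ^ L₀ :=
        u1_polyakovCorrelation_le_torusXY_pow hJE hJM _
    _ ≤ (θ ^ (Site.supNorm x / R)) ^ L₀ := pow_le_pow_left₀ h0 hle L₀
    _ = θ ^ (L₀ * (Site.supNorm x / R)) := by rw [← pow_mul, mul_comm]

/-- From a volume-uniform bound `|G_L(x̄)| ≤ C θ^{L₀⌊‖x‖_∞/R⌋}` (`0 ≤ θ < 1`, `R ≥ 1`, all large even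
boxes) to the decay of every thermodynamic limit. [folklore] -/
private theorem tendsto_zero_of_uniform_decay' {G : Type*} [Group G] [TopologicalSpace G] [IsTopologicalGroup G]
    [CompactSpace G] [MeasurableSpace G] [BorelSpace G] [SecondCountableTopology G] {N : ℕ}
    (ρ : G →* Matrix (Fin N) (Fin N) ℂ) (L₀ : ℕ) [NeZero L₀] {JE JM : ℝ} {C θ : ℝ} {R T : ℕ} (hR : 1 ≤ R)
    (hθ0 : 0 ≤ θ) (hθ1 : θ < 1)
    (hdec : ∀ (L : ℕ) [NeZero L], T ≤ L → ∀ x : Literature.Probability.LatticeModels.Site d,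
      2 * Site.supNorm x ≤ L →
        |polyakovCorrelation (L₀ := L₀) ρ JE JM (Torus.proj L x)| ≤ C * θ ^ (L₀ * (Site.supNorm x / R)))
    {Ginf : (Fin d → ℤ) → ℝ} (hG : IsThermodynamicLimit (d := d) (L₀ := L₀) ρ JE JM Ginf) :
    Tendsto Ginf cofinite (𝓝 0) := by
  obtain ⟨φ, hφ, hlim⟩ := hG
  have hbound : ∀ x : Fin d → ℤ, |Ginf x| ≤ C * θ ^ (L₀ * (Site.supNorm x / R)) := by
    intro x
    have hev : ∀ᶠ k : ℕ in atTop,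
        |polyakovCorrelation (L₀ := L₀) (L := 2 * φ k + 2) ρ JE JM (fun i => ((x i : ℤ) : ZMod (2 * φ k + 2)))| ≤
          C * θ ^ (L₀ * (Site.supNorm x / R)) := by
      have h1 : ∀ᶠ k : ℕ in atTop, T ≤ 2 * φ k + 2 ∧ 2 * Site.supNorm x ≤ 2 * φ k + 2 := by
        refine eventually_atTop.2 ⟨T + Site.supNorm x, fun k hk => ?_⟩
        have hk' : k ≤ φ k := hφ.id_le k
        constructor <;> omega
      filter_upwards [h1] with k hk
      exact hdec (2 * φ k + 2) hk.1 x hk.2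
    exact le_of_tendsto ((continuous_abs.tendsto _).comp (hlim x)) hev
  have hθL : θ ^ L₀ < 1 := pow_lt_one₀ hθ0 hθ1 (NeZero.ne L₀)
  have hq : Tendsto (fun x : Fin d → ℤ => Site.supNorm x / R) cofinite atTop := by
    refine tendsto_atTop.2 fun n => ?_
    have h := (tendsto_norm_cofinite_atTop (d := d)).eventually_ge_atTop (((n * R : ℕ) : ℝ))
    filter_upwards [h] with x hx
    rw [Site.norm_eq_supNorm] at hx
    have hx' : n * R ≤ Site.supNorm x := by exact_mod_cast hx
    exact (Nat.le_div_iff_mul_le (by omega)).2 hx'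
  have hmaj : Tendsto (fun x : Fin d → ℤ => C * θ ^ (L₀ * (Site.supNorm x / R))) cofinite (𝓝 0) := by
    have h := ((tendsto_pow_atTop_nhds_zero_of_lt_one (pow_nonneg hθ0 L₀) hθL).comp hq).const_mul C
    rw [mul_zero] at h
    refine h.congr fun x => ?_
    simp only [Function.comp_apply, ← pow_mul]
  refine squeeze_zero_norm (fun x => ?_) hmaj
  rw [Real.norm_eq_abs]
  exact hbound x

/-- ★ **`U(1)`: every thermodynamic limit of the Polyakov two-point function tends to zero for
`J_E < 2β_c(d)`** — at EVERY temporal extent `L₀` and EVERY `J_M ≥ 0` (`d ≥ 2`): Polyakov confinement on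
the strip `{0 ≤ J_E < 2β_c(d)}`, twice as wide as the strip `{J_E < β_c(d)}` obtained through the
subgroup `{±1}` (`u1_tendsto_zero_of_lt_criticalBeta`).
[cite: BorgsSeiler1983, §II.3 (II.23) (p. 337); §II.4 (II.55)–(II.56) (p. 343); §IV (pp. 358–359)] -/
theorem u1_tendsto_zero_of_lt_two_mul_criticalBeta (hd : 2 ≤ d) (L₀ : ℕ) [NeZero L₀] {JE JM : ℝ}
    (hJE : 0 ≤ JE) (hJEc : JE < 2 * criticalBeta d) (hJM : 0 ≤ JM) {Ginf : (Fin d → ℤ) → ℝ}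
    (hG : IsThermodynamicLimit (d := d) (L₀ := L₀) u1Rep JE JM Ginf) : Tendsto Ginf cofinite (𝓝 0) := by
  obtain ⟨R, θ, hR, hθ0, hθ1, hdec⟩ := u1_polyakovCorrelation_decay_of_lt_two_mul_criticalBeta hd hJE hJEc
  refine tendsto_zero_of_uniform_decay' (d := d) u1Rep L₀ (C := 1) (R := R) (T := 2 * R + 2) hR hθ0 hθ1
    (fun L _ hL x hx => ?_) hG
  obtain ⟨h0, hle⟩ := hdec L₀ JM hJM L hL x hx
  rw [abs_of_nonneg h0, one_mul]
  exact hle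

/-- ★ **`U(N)`, every `N`: Polyakov confinement at every temperature and every `J_M ≥ 0` for
`N·J_E < 2β_c(d)`** (`d ≥ 2`). [cite: BorgsSeiler1983, §II.4 (II.55)–(II.56) (p. 343); §IV (pp. 358–359)] [cite: Grosse1988, §4.2.4 (text after eq. (4.134))] -/
theorem unitaryGroup_tendsto_zero_of_lt_two_mul_criticalBeta (hd : 2 ≤ d) {N : ℕ} (L₀ : ℕ) [NeZero L₀]
    {JE JM : ℝ} (hJE : 0 ≤ JE) (hJEc : (N : ℝ) * JE < 2 * criticalBeta d) (hJM : 0 ≤ JM)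
    {Ginf : (Fin d → ℤ) → ℝ}
    (hG : IsThermodynamicLimit (d := d) (L₀ := L₀) (unitaryFundamentalRep (Fin N) ℂ) JE JM Ginf) :
    Tendsto Ginf cofinite (𝓝 0) := by
  obtain ⟨R, θ, hR, hθ0, hθ1, hdec⟩ :=
    u1_polyakovCorrelation_decay_of_lt_two_mul_criticalBeta hd (by positivity : 0 ≤ (N : ℝ) * JE) hJEc
  refine tendsto_zero_of_uniform_decay' (d := d) (unitaryFundamentalRep (Fin N) ℂ) L₀ (C := (N : ℝ) ^ 2)
    (R := R) (T := 2 * R + 2) hR hθ0 hθ1 (fun L _ hL x hx => ?_) hG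
  have h2 := (hdec L₀ ((N : ℝ) * JM) (by positivity) L hL x hx).2
  exact (unitaryGroup_abs_polyakovCorrelation_le_u1 (L₀ := L₀) hJE hJM _).trans
    (mul_le_mul_of_nonneg_left h2 (by positivity))

/-- **`U(1)`: Polyakov long-range order forces `J_E ≥ 2β_c(d)`** at every temporal extent (`d ≥ 2`,
`J_M ≥ 0`) — a temperature-independent lower bound on the `U(1)` deconfining coupling, to be compared
with Borgs–Seiler's upper bound `2L₀(d·I_d + 1)` (tree `u1_hasPolyakovLongRangeOrder_of_lt`).
[cite: BorgsSeiler1983, §III.3 (p. 354); §IV (pp. 358–359)] -/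
theorem u1_two_mul_criticalBeta_le_of_hasPolyakovLongRangeOrder (hd : 2 ≤ d) (L₀ : ℕ) [NeZero L₀]
    {JE JM : ℝ} (hJE : 0 ≤ JE) (hJM : 0 ≤ JM) (h : HasPolyakovLongRangeOrder d L₀ u1Rep JE JM) :
    2 * criticalBeta d ≤ JE := by
  by_contra hlt
  push Not at hlt
  obtain ⟨Ginf, hG⟩ := exists_isThermodynamicLimit (d := d) (L₀ := L₀) u1Rep continuous_u1Rep
    u1Rep_mem_unitaryGroup JE JM
  exact h Ginf hG (u1_tendsto_zero_of_lt_two_mul_criticalBeta hd L₀ hJE hlt hJM hG)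

/-- **`U(N)`: Polyakov long-range order forces `N·J_E ≥ 2β_c(d)`** at every temporal extent (`d ≥ 2`).
[cite: BorgsSeiler1983, §III.2 Thm III.7 (p. 353); §IV (pp. 358–359)] -/
theorem unitaryGroup_two_mul_criticalBeta_le_of_hasPolyakovLongRangeOrder (hd : 2 ≤ d) {N : ℕ} (L₀ : ℕ)
    [NeZero L₀] {JE JM : ℝ} (hJE : 0 ≤ JE) (hJM : 0 ≤ JM)
    (h : HasPolyakovLongRangeOrder d L₀ (unitaryFundamentalRep (Fin N) ℂ) JE JM) :
    2 * criticalBeta d ≤ (N : ℝ) * JE := by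
  by_contra hlt
  push Not at hlt
  obtain ⟨Ginf, hG⟩ := exists_isThermodynamicLimit (d := d) (L₀ := L₀) (unitaryFundamentalRep (Fin N) ℂ)
    (continuous_unitaryFundamentalRep (Fin N) ℂ) (fun g => g.2) JE JM
  exact h Ginf hG (unitaryGroup_tendsto_zero_of_lt_two_mul_criticalBeta hd L₀ hJE hlt hJM hG)

end U1

/-! ### 6. `ℤ_n` with `n` odd and `SU(N)` through an odd central subgroup: the clock-layer stack bound -/

section ZnOdd

variable {d L₀ L : ℕ}

/-- ★ **`ℤ_n`, `n` odd: the `J_M → ∞` bound with the `ℤ_n` clock layer** —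
`G_L^{ℤ_n}(x; J_E, J_M) ≤ (⟨Re(σ_0 σ̄_x)⟩^{ℤ_n-clock}_{(ℤ/L)^d, J_E})^{L₀}` for `J_E, J_M ≥ 0`, every `L₀`, `L`,
`x` (the layer two-point function `AbelianStack.layerTwoPoint d L (znIncl n)` is that of the
`n`-state clock model on the torus with bond weights `e^{J_E cos(2π(k_v − k_{v+e_i})/n)}`).
[cite: BorgsSeiler1983, §IV (pp. 358–359)] [cite: Ginibre1970, Prop. 3 with §2 Model 2, eqs. (2.22)–(2.24)] -/
theorem zn_polyakovCorrelation_le_clockLayer_pow_of_odd [NeZero L₀] [NeZero L] {n : ℕ} (hn : Odd n)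
    {JE JM : ℝ} (hJE : 0 ≤ JE) (hJM : 0 ≤ JM) (x : TorusSite d L) :
    polyakovCorrelation (L₀ := L₀) (znRep n) JE JM x ≤
      AbelianStack.layerTwoPoint d L (znIncl n) JE x ^ L₀ := by
  have h := AbelianStack.polyakovCorrelation_le_frozen (d := d) (L₀ := L₀) (L := L) (znIncl n)
    (surjective_mul_self_rootsOfUnityCircle hn) (fun a b hab => Subtype.ext hab) hJE hJM x
  rwa [AbelianStack.frozenExpectation_pairChar, charRep_znIncl] at h

/-- ★ **`SU(N)` through an odd central subgroup `ℤ_n ⊆ ℤ_N` (`n ∣ N`, `n` odd; `n = N` for `N` odd):**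
`|G_L^{SU(N)}(x; J_E, J_M)| ≤ N² (⟨Re(σ_0 σ̄_x)⟩^{ℤ_n-clock}_{(ℤ/L)^d, N J_E})^{L₀}` (centre domination, tree
`specialUnitaryGroup_abs_polyakovCorrelation_le_zn_of_neZero`, ∘ the clock-layer stack bound). A
subcritical-decay input for the `ℤ_n` clock model on tori — not in the tree — would turn this into a
temperature-independent confinement window for `SU(N)` with `N` odd, exactly as the Ising / XY inputs
do for even `N` / `U(N)`. [cite: Grosse1988, §4.2.4 eq. (4.134)] [cite: BorgsSeiler1983, §IV (pp. 358–359)] -/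
theorem suN_abs_polyakovCorrelation_le_clockLayer_pow [NeZero L₀] [NeZero L] {n N : ℕ} [NeZero n]
    (hn : Odd n) (hnN : n ∣ N) {JE JM : ℝ} (hJE : 0 ≤ JE) (hJM : 0 ≤ JM) (x : TorusSite d L) :
    |polyakovCorrelation (L₀ := L₀) (fundamentalRep (Fin N)) JE JM x| ≤
      (N : ℝ) ^ 2 * AbelianStack.layerTwoPoint d L (znIncl n) ((N : ℝ) * JE) x ^ L₀ :=
  (specialUnitaryGroup_abs_polyakovCorrelation_le_zn_of_neZero (L₀ := L₀) hnN hJE hJM x).trans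
    (mul_le_mul_of_nonneg_left
      (zn_polyakovCorrelation_le_clockLayer_pow_of_odd hn (by positivity) (by positivity) x) (by positivity))

/-- **`SU(3)`: `|G_L^{SU(3)}(x; J_E, J_M)| ≤ 9 (⟨Re(σ_0 σ̄_x)⟩^{ℤ₃-clock}_{(ℤ/L)^d, 3J_E})^{L₀}`** for
`J_E, J_M ≥ 0`, every `L₀`, `L`, `x`. [cite: Grosse1988, §4.2.4 eq. (4.134)] [cite: BorgsSeiler1983, §IV (pp. 358–359)] -/
theorem su3_abs_polyakovCorrelation_le_clockLayer_pow [NeZero L₀] [NeZero L] {JE JM : ℝ} (hJE : 0 ≤ JE)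
    (hJM : 0 ≤ JM) (x : TorusSite d L) :
    |polyakovCorrelation (L₀ := L₀) (fundamentalRep (Fin 3)) JE JM x| ≤
      9 * AbelianStack.layerTwoPoint d L (znIncl 3) (3 * JE) x ^ L₀ := by
  have h := suN_abs_polyakovCorrelation_le_clockLayer_pow (d := d) (L₀ := L₀) (L := L) (n := 3) (N := 3)
    ⟨1, rfl⟩ (dvd_refl 3) hJE hJM x
  norm_num at h
  exact h

/-- **Transfer along Polyakov's criterion, conditional form**: a volume-uniform subcritical decay
bound for the `ℤ_n` clock layer at coupling `N J_E` (the missing input, taken here as an explicit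
HYPOTHESIS `hdec`, not as a fact) gives Polyakov confinement of `SU(N)` at `(J_E, J_M)` at every
temporal extent, `J_M ≥ 0`, for every odd `n ∣ N`. [cite: BorgsSeiler1983, §II.3 (II.23) (p. 337); §IV (pp. 358–359)] -/
theorem suN_tendsto_zero_of_clockLayer_decay {n N : ℕ} [NeZero n] (hn : Odd n) (hnN : n ∣ N) (L₀ : ℕ)
    [NeZero L₀] {JE JM : ℝ} (hJE : 0 ≤ JE) (hJM : 0 ≤ JM) {R T : ℕ} {θ : ℝ} (hR : 1 ≤ R) (hθ0 : 0 ≤ θ)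
    (hθ1 : θ < 1)
    (hdec : ∀ (L : ℕ) [NeZero L], T ≤ L → ∀ x : Literature.Probability.LatticeModels.Site d,
      2 * Site.supNorm x ≤ L →
        0 ≤ AbelianStack.layerTwoPoint d L (znIncl n) ((N : ℝ) * JE) (Torus.proj L x) ∧
          AbelianStack.layerTwoPoint d L (znIncl n) ((N : ℝ) * JE) (Torus.proj L x) ≤ θ ^ (Site.supNorm x / R))
    {Ginf : (Fin d → ℤ) → ℝ}
    (hG : IsThermodynamicLimit (d := d) (L₀ := L₀) (fundamentalRep (Fin N)) JE JM Ginf) :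
    Tendsto Ginf cofinite (𝓝 0) := by
  refine tendsto_zero_of_uniform_decay' (d := d) (fundamentalRep (Fin N)) L₀ (C := (N : ℝ) ^ 2) (R := R)
    (T := T) hR hθ0 hθ1 (fun L _ hL x hx => ?_) hG
  obtain ⟨h0, hle⟩ := hdec L hL x hx
  refine (suN_abs_polyakovCorrelation_le_clockLayer_pow (L₀ := L₀) hn hnN hJE hJM _).trans
    (mul_le_mul_of_nonneg_left ?_ (by positivity))
  calc AbelianStack.layerTwoPoint d L (znIncl n) ((N : ℝ) * JE) (Torus.proj L x) ^ L₀
      ≤ (θ ^ (Site.supNorm x / R)) ^ L₀ := pow_le_pow_left₀ h0 hle L₀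
    _ = θ ^ (L₀ * (Site.supNorm x / R)) := by rw [← pow_mul, mul_comm]

end ZnOdd

end Literature.MathematicalPhysics.QuantumFieldTheory

end
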